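import Summits.QuantumFields.YangMills.Theses.HyperbolicRegulator
import Literature.MathematicalPhysics.QuantumLattice.GaugeGroupsProofs
import Literature.MathematicalPhysics.QuantumFieldTheory.YangMillsOS

/-!
# `CurvatureAnchorR` (stmt-QuantumFields-18155) — Negative: every admissible complex has Euler characteristic `−|K|/4 ≤ −1`

Refuter (cdisprove `refuter-cdisprove-stmt-QuantumFields-18155-0`, 2026-08-17) structural lemma for the crux
`Summit.QuantumFields.YangMills.Theses.HyperbolicRegulator.CurvatureAnchorR` (route file rev 5), `G`-free.

For the route's square-complex encoding (`V E Q : Finset ℕ`, endpoints `σ τ`, square boundary darts `bd q : Fin 4 → ℕ × Bool`,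
degree `dg x = #{e ∈ E | σ e = x ∨ τ e = x}`, cones `K = {x ∈ V | dg x = 5}`) the admissibility clauses 1, 2, 4 alone force

  `2|E| = 4|V| + |K|`  (handshake: degrees are `4` off `K` and `5` on `K`),
  `|E| = 2|Q|`          (each vertex lies on `dg x` squares, each square has `4` distinct corners),

hence `4|Q| = 4|V| + |K|`, i.e. `χ := |V| − |E| + |Q| = −|K|/4`; clauses 5 and 8 give `K ≠ ∅`, so `4 ≤ |K|` and `χ ≤ −1`
(`admissible_euler`, `admissible_cones`, packaged against the crux's inlined admissibility predicate in `admR_euler`, and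
against the crux itself — instantiated at the certified `SU(2)` — in `curvatureAnchorR_euler`).

Reading (toron obstruction, for the crux's ideators / the `witten_hessian` and `giant_beta_gjs` lines): no admissible
complex is a sphere, a torus or simply connected; with the no-pinch clause of `Tame` it is a closed square surface with
`b₁(S; 𝔽₂) = 2 − χ ≥ 3`, so the flat-connection (toron) sector of `S × S` is non-trivial at EVERY `(k, j)` and any proof of
the clustering conjunct must control it (it cannot be typed away by a choice of family).  The count is exact on the
intended `{4,5}_k` models (`|K| = ` number of big vertices, `χ = −|K|/4`). [folklore]
-/

set_option autoImplicit false

namespace Summit.QuantumFields.YangMills.Theorems.CurvatureAnchorR.Negative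

open Finset

/-- **Handshake** for the route's edge encoding: endpoints distinct and in `V` ⇒ `∑_{x ∈ V} dg x = 2|E|`. -/
theorem admissible_handshake {V E : Finset ℕ} {σ τ : ℕ → ℕ}
    (h1 : ∀ e ∈ E, σ e ∈ V ∧ τ e ∈ V ∧ σ e ≠ τ e) :
    ∑ x ∈ V, (E.filter fun e => σ e = x ∨ τ e = x).card = 2 * E.card := by
  classical
  simp_rw [Finset.card_filter]
  rw [Finset.sum_comm]
  calc ∑ e ∈ E, ∑ x ∈ V, (if σ e = x ∨ τ e = x then 1 else 0) = ∑ _e ∈ E, 2 := by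
        refine Finset.sum_congr rfl fun e he => ?_
        obtain ⟨hs, ht, hne⟩ := h1 e he
        rw [← Finset.card_filter]
        have hpair : (V.filter fun x => σ e = x ∨ τ e = x) = {σ e, τ e} := by
          ext x
          simp only [Finset.mem_filter, Finset.mem_insert, Finset.mem_singleton]
          constructor
          · rintro ⟨-, h | h⟩
            · exact Or.inl h.symm
            · exact Or.inr h.symm
          · rintro (rfl | rfl)
            · exact ⟨hs, Or.inl rfl⟩
            · exact ⟨ht, Or.inr rfl⟩
        rw [hpair, Finset.card_pair hne]
    _ = 2 * E.card := by rw [Finset.sum_const, smul_eq_mul, mul_comm]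

/-- **Corner count**: if the four corners `st (bd q i)` of every square are distinct and its darts are edges, then
`∑_{x ∈ V} #{q ∈ Q | x is a corner of q} = 4|Q|`. -/
theorem admissible_corner_count {V E Q : Finset ℕ} {σ τ : ℕ → ℕ} {bd : ℕ → Fin 4 → ℕ × Bool}
    (h1 : ∀ e ∈ E, σ e ∈ V ∧ τ e ∈ V ∧ σ e ≠ τ e)
    (hE : ∀ q ∈ Q, ∀ i, (bd q i).1 ∈ E)
    (hinj : ∀ q ∈ Q, Function.Injective fun i => if (bd q i).2 then σ (bd q i).1 else τ (bd q i).1) :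
    ∑ x ∈ V, (Q.filter fun q => ∃ i, (if (bd q i).2 then σ (bd q i).1 else τ (bd q i).1) = x).card = 4 * Q.card := by
  classical
  simp_rw [Finset.card_filter]
  rw [Finset.sum_comm]
  calc ∑ q ∈ Q, ∑ x ∈ V, (if ∃ i, (if (bd q i).2 then σ (bd q i).1 else τ (bd q i).1) = x then 1 else 0)
        = ∑ _q ∈ Q, 4 := by
        refine Finset.sum_congr rfl fun q hq => ?_
        rw [← Finset.card_filter]
        have himg : (V.filter fun x => ∃ i, (if (bd q i).2 then σ (bd q i).1 else τ (bd q i).1) = x)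
            = Finset.univ.image fun i => if (bd q i).2 then σ (bd q i).1 else τ (bd q i).1 := by
          ext x
          simp only [Finset.mem_filter, Finset.mem_image, Finset.mem_univ, true_and]
          constructor
          · rintro ⟨-, i, hi⟩
            exact ⟨i, hi⟩
          · rintro ⟨i, hi⟩
            refine ⟨?_, i, hi⟩
            rw [← hi]
            obtain ⟨hs, ht, -⟩ := h1 _ (hE q hq i)
            split <;> assumption
        rw [himg, Finset.card_image_of_injective _ (hinj q hq), Finset.card_univ, Fintype.card_fin]
    _ = 4 * Q.card := by rw [Finset.sum_const, smul_eq_mul, mul_comm]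

/-- **Euler identity** from admissibility clauses 1, 2, 4: `2|E| = 4|V| + |K|` and `|E| = 2|Q|`
(so `4|Q| = 4|V| + |K|` and `χ = |V| − |E| + |Q| = −|K|/4`). -/
theorem admissible_euler {V E Q : Finset ℕ} {σ τ : ℕ → ℕ} {bd : ℕ → Fin 4 → ℕ × Bool}
    (h1 : ∀ e ∈ E, σ e ∈ V ∧ τ e ∈ V ∧ σ e ≠ τ e)
    (hE : ∀ q ∈ Q, ∀ i, (bd q i).1 ∈ E)
    (hinj : ∀ q ∈ Q, Function.Injective fun i => if (bd q i).2 then σ (bd q i).1 else τ (bd q i).1)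
    (h4 : ∀ x ∈ V, ((E.filter fun e => σ e = x ∨ τ e = x).card = 4 ∨ (E.filter fun e => σ e = x ∨ τ e = x).card = 5) ∧
      (Q.filter fun q => ∃ i, (if (bd q i).2 then σ (bd q i).1 else τ (bd q i).1) = x).card
        = (E.filter fun e => σ e = x ∨ τ e = x).card) :
    2 * E.card = 4 * V.card + (V.filter fun x => (E.filter fun e => σ e = x ∨ τ e = x).card = 5).card ∧
      E.card = 2 * Q.card := by
  classical
  have hS := admissible_handshake h1
  have hC := admissible_corner_count h1 hE hinj
  have hK : (V.filter fun x => (E.filter fun e => σ e = x ∨ τ e = x).card = 5).card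
      = ∑ x ∈ V, (if (E.filter fun e => σ e = x ∨ τ e = x).card = 5 then 1 else 0) := Finset.card_filter _ _
  have hdeg : ∑ x ∈ V, (E.filter fun e => σ e = x ∨ τ e = x).card
      = ∑ x ∈ V, (4 + if (E.filter fun e => σ e = x ∨ τ e = x).card = 5 then 1 else 0) := by
    refine Finset.sum_congr rfl fun x hx => ?_
    rcases (h4 x hx).1 with h | h <;> simp [h]
  rw [Finset.sum_add_distrib, Finset.sum_const, smul_eq_mul, ← hK] at hdeg
  have hsq : ∑ x ∈ V, (Q.filter fun q => ∃ i, (if (bd q i).2 then σ (bd q i).1 else τ (bd q i).1) = x).card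
      = ∑ x ∈ V, (E.filter fun e => σ e = x ∨ τ e = x).card :=
    Finset.sum_congr rfl fun x hx => (h4 x hx).2
  omega

/-- **At least four cones**: with clauses 5 (every vertex within `k` of a cone) and 8 (a deep vertex exists) the cone
set is non-empty, and `4|Q| = 4|V| + |K|` makes `|K|` a positive multiple of `4`. -/
theorem admissible_cones {V E Q : Finset ℕ} {σ τ : ℕ → ℕ} {bd : ℕ → Fin 4 → ℕ × Bool}
    (h1 : ∀ e ∈ E, σ e ∈ V ∧ τ e ∈ V ∧ σ e ≠ τ e)
    (hE : ∀ q ∈ Q, ∀ i, (bd q i).1 ∈ E)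
    (hinj : ∀ q ∈ Q, Function.Injective fun i => if (bd q i).2 then σ (bd q i).1 else τ (bd q i).1)
    (h4 : ∀ x ∈ V, ((E.filter fun e => σ e = x ∨ τ e = x).card = 4 ∨ (E.filter fun e => σ e = x ∨ τ e = x).card = 5) ∧
      (Q.filter fun q => ∃ i, (if (bd q i).2 then σ (bd q i).1 else τ (bd q i).1) = x).card
        = (E.filter fun e => σ e = x ∨ τ e = x).card)
    (hK : (V.filter fun x => (E.filter fun e => σ e = x ∨ τ e = x).card = 5).Nonempty) :
    4 ≤ (V.filter fun x => (E.filter fun e => σ e = x ∨ τ e = x).card = 5).card ∧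
      V.card + 1 ≤ Q.card := by
  have h := admissible_euler h1 hE hinj h4
  have hpos := hK.card_pos
  omega

/-- **Packaged against the crux's admissibility predicate** (the inlined `(Fam k j …).1` of `CurvatureAnchorR`, verbatim —
the same text as `AdmR` of `Cruxes/CurvatureAnchorR/Lines/*.lean`, so it applies to `hA : AdmR k j …` by `exact`):
`2|E| = 4|V| + |K|`, `|E| = 2|Q|`, `4 ≤ |K|`, `|V| + 1 ≤ |Q|` — Euler characteristic `|V| − |E| + |Q| = −|K|/4 ≤ −1`. -/
theorem admR_euler (k j : ℕ) (V E Q : Finset ℕ) (σ τ : ℕ → ℕ) (bd : ℕ → Fin 4 → ℕ × Bool) (cV : ℕ → ℤ × ℤ → ℕ)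
    (cE : ℕ → ℤ × ℤ → Fin 2 → ℕ × Bool)
    (hA : let st := fun e : ℕ × Bool => if e.2 then σ e.1 else τ e.1; let en := fun e : ℕ × Bool => if e.2 then τ e.1 else σ e.1; let Γ := SimpleGraph.fromRel fun a b : ℕ => ∃ e ∈ E, σ e = a ∧ τ e = b; let dg := fun x : ℕ => (E.filter fun e => σ e = x ∨ τ e = x).card; let K := V.filter fun x => dg x = 5; let F := fun x : ℕ => x ∈ V ∧ ∀ c ∈ K, k / 2 < Γ.dist x c; let Dp := fun x : ℕ => x ∈ V ∧ ∀ c ∈ K, 3 * (k / 4) < Γ.dist x c; let ib := fun a : ℤ × ℤ => |a.1| ≤ (k : ℤ) / 4 ∧ |a.2| ≤ (k : ℤ) / 4; let nx := fun (a : ℤ × ℤ) (μ : Fin 2) => if μ = 0 then (a.1 + 1, a.2) else (a.1, a.2 + 1); (∀ e ∈ E, σ e ∈ V ∧ τ e ∈ V ∧ σ e ≠ τ e) ∧ (∀ q ∈ Q, (∀ i, (bd q i).1 ∈ E) ∧ (∀ i, en (bd q i) = st (bd q (i + 1))) ∧ (st ∘ bd q).Injective) ∧ (∀ e ∈ E,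 (Q.filter fun q => ∃ i, (bd q i).1 = e).card = 2) ∧ (∀ x ∈ V, (dg x = 4 ∨ dg x = 5) ∧ (Q.filter fun q => ∃ i, st (bd q i) = x).card = dg x) ∧ (∀ x ∈ V, ∃ c ∈ K, Γ.dist x c ≤ k) ∧ (∀ c ∈ K, ∀ c' ∈ K, c ≠ c' → k ≤ Γ.dist c c') ∧ (∀ f : ℕ → ℝ, ∑ x ∈ V, f x = 0 → ∑ x ∈ V, f x ^ 2 ≤ 10 ^ 6 * (k : ℝ) ^ 2 * ∑ e ∈ E, (f (σ e) - f (τ e)) ^ 2) ∧ (∃ x y, Dp x ∧ Dp y ∧ j ≤ Γ.dist x y) ∧ (∀ x, F x → cV x (0, 0) = x ∧ (∀ a, ib a → cV x a ∈ V) ∧ Set.InjOn (cV x) {a | ib a} ∧ (∀ a μ, ib a → ib (nx a μ) → (cE x a μ).1 ∈ E ∧ st (cE x a μ) = cV x a ∧ en (cE x a μ) = cV x (nx a μ)) ∧ (∀ a, ib a → ib (a.1 + 1, a.2 + 1) → ∃ q ∈ Q, Finset.univ.image (Prod.fst ∘ bd q) = {(cE x a 0).1, (cE x (nx a 0) 1).1,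 (cE x (nx a 1) 0).1, (cE x a 1).1}))) :
    2 * E.card = 4 * V.card + (V.filter fun x => (E.filter fun e => σ e = x ∨ τ e = x).card = 5).card ∧
      E.card = 2 * Q.card ∧ 4 ≤ (V.filter fun x => (E.filter fun e => σ e = x ∨ τ e = x).card = 5).card ∧
      V.card + 1 ≤ Q.card := by
  obtain ⟨h1, h2, -, h4, h5, -, -, ⟨x, -, ⟨hxV, -⟩, -, -⟩, -⟩ := hA
  have hE : ∀ q ∈ Q, ∀ i, (bd q i).1 ∈ E := fun q hq => (h2 q hq).1
  have hinj : ∀ q ∈ Q, Function.Injective fun i => if (bd q i).2 then σ (bd q i).1 else τ (bd q i).1 :=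
    fun q hq => (h2 q hq).2.2
  have hK : (V.filter fun x => (E.filter fun e => σ e = x ∨ τ e = x).card = 5).Nonempty := by
    obtain ⟨c, hc, -⟩ := h5 x hxV
    exact ⟨c, hc⟩
  obtain ⟨hS, hQ⟩ := admissible_euler h1 hE hinj h4
  obtain ⟨h4K, hVQ⟩ := admissible_cones h1 hE hinj h4 hK
  exact ⟨hS, hQ, h4K, hVQ⟩

open Literature.MathematicalPhysics.QuantumFieldTheory Literature.MathematicalPhysics.QuantumLattice MeasureTheory in
/-- **Corollary for the crux itself**: if `CurvatureAnchorR` holds then (instantiating at the certified compact simple Lie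
group `SU(2)`) its family consists, at every `k ≥ 8` and every `j`, of complexes with `2|E| = 4|V| + |K|`, `|E| = 2|Q|`,
`4 ≤ |K|`, `|V| + 1 ≤ |Q|` — Euler characteristic `−|K|/4 ≤ −1`, never simply connected.  (A consequence, not a
refutation: the item stays open.) -/
theorem curvatureAnchorR_euler (h : open Literature.MathematicalPhysics.QuantumFieldTheory Literature.MathematicalPhysics.QuantumLattice MeasureTheory in ∀ (G : Type) [Group G] [TopologicalSpace G] [IsTopologicalGroup G] [CompactSpace G], IsCompactSimpleLieGroup G → letI : MeasurableSpace G := borel G; haveI : BorelSpace G := ⟨rfl⟩; ∀ r : LatticeRep G, let Fam := fun (k j : ℕ) (V E Q : Finset ℕ) (σ τ : ℕ → ℕ) (bd : ℕ → Fin 4 → ℕ × Bool) (cV : ℕ → ℤ × ℤ → ℕ) (cE : ℕ → ℤ × ℤ → Fin 2 → ℕ × Bool) => let st := fun e : ℕ × Bool => if e.2 then σ e.1 else τ e.1; let en := fun e : ℕ × Bool => if e.2 then τ e.1 else σ e.1; let Γ := SimpleGraph.fromRel fun a b : ℕ => ∃ e ∈ E, σ e = a ∧ τ e = b; let dg :=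 fun x : ℕ => (E.filter fun e => σ e = x ∨ τ e = x).card; let K := V.filter fun x => dg x = 5; let F := fun x : ℕ => x ∈ V ∧ ∀ c ∈ K, k / 2 < Γ.dist x c; let Dp := fun x : ℕ => x ∈ V ∧ ∀ c ∈ K, 3 * (k / 4) < Γ.dist x c; let ib := fun a : ℤ × ℤ => |a.1| ≤ (k : ℤ) / 4 ∧ |a.2| ≤ (k : ℤ) / 4; let nx := fun (a : ℤ × ℤ) (μ : Fin 2) => if μ = 0 then (a.1 + 1, a.2) else (a.1, a.2 + 1); let Ed := (ℕ × ℕ) ⊕ (ℕ × ℕ); let PE : Finset Ed := (E ×ˢ V).disjSum (V ×ˢ E); let Cfg := ↥PE → G; let ν := Measure.pi fun _ : ↥PE => haarProbability G; let v := fun (U : Cfg) (e : Ed × Bool) => if h : e.1 ∈ PE then (if e.2 then U ⟨e.1, h⟩ else (U ⟨e.1, h⟩)⁻¹) else 1; let w := fun (U : Cfg) (e : Fin 4 → Ed × Bool) => (r.ρ (v U (e 0) * v U (e 1) * v U (e 2) * v U (e 3))).trace.re; let S := fun U : Cfg => (∑ q ∈ Q, ∑ y ∈ V, w U fun i => (Sum.inl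 ((bd q i).1, y), (bd q i).2)) + (∑ y ∈ V, ∑ q ∈ Q, w U fun i => (Sum.inr (y, (bd q i).1), (bd q i).2)) + ∑ e ∈ E, ∑ e' ∈ E, w U ![(Sum.inl (e, σ e'), true), (Sum.inr (τ e, e'), true), (Sum.inl (e, τ e'), false), (Sum.inr (σ e, e'), false)]; let d0 : Fin 4 → Fin 2 := ![0, 1, 0, 1]; let P := fun (x x' : ℕ) (U : Cfg) (p : ZdEdge 4) => let a := (p.1 0, p.1 1); let b := (p.1 2, p.1 3); if p.2 = 0 ∨ p.2 = 1 then v U (Sum.inl ((cE x a (d0 p.2)).1, cV x' b), (cE x a (d0 p.2)).2) else v U (Sum.inr (cV x a, (cE x' b (d0 p.2)).1), (cE x' b (d0 p.2)).2); ((∀ e ∈ E, σ e ∈ V ∧ τ e ∈ V ∧ σ e ≠ τ e) ∧ (∀ q ∈ Q, (∀ i, (bd q i).1 ∈ E) ∧ (∀ i, en (bd q i) = st (bd q (i + 1))) ∧ (st ∘ bd q).Injective) ∧ (∀ e ∈ E, (Q.filter fun q => ∃ i, (bd q i).1 = e).card = 2) ∧ (∀ x ∈ V, (dg x = 4 ∨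 dg x = 5) ∧ (Q.filter fun q => ∃ i, st (bd q i) = x).card = dg x) ∧ (∀ x ∈ V, ∃ c ∈ K, Γ.dist x c ≤ k) ∧ (∀ c ∈ K, ∀ c' ∈ K, c ≠ c' → k ≤ Γ.dist c c') ∧ (∀ f : ℕ → ℝ, ∑ x ∈ V, f x = 0 → ∑ x ∈ V, f x ^ 2 ≤ 10 ^ 6 * (k : ℝ) ^ 2 * ∑ e ∈ E, (f (σ e) - f (τ e)) ^ 2) ∧ (∃ x y, Dp x ∧ Dp y ∧ j ≤ Γ.dist x y) ∧ (∀ x, F x → cV x (0, 0) = x ∧ (∀ a, ib a → cV x a ∈ V) ∧ Set.InjOn (cV x) {a | ib a} ∧ (∀ a μ, ib a → ib (nx a μ) → (cE x a μ).1 ∈ E ∧ st (cE x a μ) = cV x a ∧ en (cE x a μ) = cV x (nx a μ)) ∧ (∀ a, ib a → ib (a.1 + 1, a.2 + 1) → ∃ q ∈ Q, Finset.univ.image (Prod.fst ∘ bd q) = {(cE x a 0).1, (cE x (nx a 0) 1).1, (cE x (nx a 1) 0).1, (cE x a 1).1})), fun (β m C : ℝ) (A B : YMSpecies G) => let X :=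 fun f : Cfg → ℝ => (∫ U, f U * Real.exp (β * S U) ∂ν) / (∫ U, Real.exp (β * S U) ∂ν); ∀ x x' y y', F x → F x' → F y → F y' → |X (fun U => A.F (P x x' U) * B.F (P y y' U)) - X (fun U => A.F (P x x' U)) * X (fun U => B.F (P y y' U))| ≤ C * Real.exp (-(m * ((Γ.dist x y + Γ.dist x' y' : ℕ) : ℝ)))); let Sp := fun (A : YMSpecies G) (R : ℕ) => ∀ p ∈ A.supp, ∀ i, |p.1 i| ≤ (R : ℤ); ∃ (V E Q : ℕ → ℕ → Finset ℕ) (σ τ : ℕ → ℕ → ℕ → ℕ) (bd : ℕ → ℕ → ℕ → Fin 4 → ℕ × Bool) (cV : ℕ → ℕ → ℕ → ℤ × ℤ → ℕ) (cE : ℕ → ℕ → ℕ → ℤ × ℤ → Fin 2 → ℕ × Bool), let Φ := fun k j => Fam k j (V k j) (E k j) (Q k j) (σ k j) (τ k j) (bd k j) (cV k j) (cE k j); (∀ k j, 8 ≤ k → (Φ k j).1) ∧ (∃ c : ℝ, 0 < c ∧ ∀ k, 8 ≤ k → ∃ β₀ : ℝ, ∀ β, β₀ ≤ β → ∀ A B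 : YMSpecies G, Sp A (k / 8) → Sp B (k / 8) → ∃ C j₀, ∀ j, j₀ ≤ j → (Φ k j).2 β (c / k) C A B)) :
    ∃ (V E Q : ℕ → ℕ → Finset ℕ) (σ τ : ℕ → ℕ → ℕ → ℕ),
      ∀ k j : ℕ, 8 ≤ k →
        2 * (E k j).card = 4 * (V k j).card
            + ((V k j).filter fun x => ((E k j).filter fun e => σ k j e = x ∨ τ k j e = x).card = 5).card ∧
        (E k j).card = 2 * (Q k j).card ∧
        4 ≤ ((V k j).filter fun x => ((E k j).filter fun e => σ k j e = x ∨ τ k j e = x).card = 5).card ∧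
        (V k j).card + 1 ≤ (Q k j).card := by
  have hG : IsCompactSimpleLieGroup (Matrix.specialUnitaryGroup (Fin 2) ℂ) :=
    isCompactSimpleLieGroup_specialUnitaryGroup isSimpleCompactGroup_specialUnitaryGroup_holds le_rfl
  obtain ⟨r⟩ := hG.2
  obtain ⟨V, E, Q, σ, τ, bd, cV, cE, hAdm, -⟩ := h (Matrix.specialUnitaryGroup (Fin 2) ℂ) hG r
  exact ⟨V, E, Q, σ, τ, fun k j hk => admR_euler k j (V k j) (E k j) (Q k j) (σ k j) (τ k j) (bd k j) (cV k j) (cE k j)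
    (hAdm k j hk)⟩

/-- Signature match: the hypothesis of `curvatureAnchorR_euler` is literally the route decl. -/
example (h : Summit.QuantumFields.YangMills.Theses.HyperbolicRegulator.CurvatureAnchorR) :
    ∃ (V E Q : ℕ → ℕ → Finset ℕ) (σ τ : ℕ → ℕ → ℕ → ℕ),
      ∀ k j : ℕ, 8 ≤ k →
        2 * (E k j).card = 4 * (V k j).card
            + ((V k j).filter fun x => ((E k j).filter fun e => σ k j e = x ∨ τ k j e = x).card = 5).card ∧
        (E k j).card = 2 * (Q k j).card ∧
        4 ≤ ((V k j).filter fun x => ((E k j).filter fun e => σ k j e = x ∨ τ k j e = x).card = 5).card ∧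
        (V k j).card + 1 ≤ (Q k j).card :=
  curvatureAnchorR_euler h

end Summit.QuantumFields.YangMills.Theorems.CurvatureAnchorR.Negative
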